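import Summits.QuantumFields.YangMills.Theses.ThermodynamicCeilings

/-!
# Route `ThermodynamicCeilings` — discrete spectral measures `Σ_i w_i δ_{E_i}` (support for the pair spectral representation)

D-0145 ideator seat ym-idea-11 (g5).  Step 5 of the proof plan (`rep_plan.md`, evidence on items 27771/27776) for the pair
spectral representation H (hypothesis of `mirrorMonotoneDecay_of_pairSpectralRepresentation`, clause (i) of cruxes 27501/27776):
the transfer-matrix formalism produces the pair correlation as a countable sum `κ₀ + Σ_p w_p (e^{-E_p(t-δ)} + e^{-E_p(N-δ-t)})` with
`w_p ≥ 0` summable and `E_p > 0`; the clause wants a finite Borel measure `ν` on `(0,∞)`.  This file packages the passage: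
for the measure `Measure.sum (fun i => ENNReal.ofReal (w i) • Measure.dirac (E i))` — finiteness (`isFiniteMeasure_sum_dirac`),
`ν((-∞,0]) = 0` (`sum_dirac_Iic_zero`), and `∫ g dν = Σ_i w_i g(E_i)` as a `HasSum` for every measurable `g` bounded on `(0,∞)`
(`hasSum_integral_sum_dirac`), with the two-exponential integrand of clause (i) as the corollary `hasSum_pairProfile_sum_dirac`.
Pure Mathlib; closes nothing; no summit / leaf / NT / UV / IR statement is proved.
-/

namespace Summit.QuantumFields.YangMills.Cruxes.MirrorMonotoneDecay.DiscreteSpectral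

open MeasureTheory Set

variable {ι : Type*}

/-- total mass of `Σ_i w_i δ_{E_i}` on a measurable set: `Σ_i ofReal(w_i) · 𝟙_s(E_i)`. -/
theorem sum_dirac_apply (w E : ι → ℝ) {s : Set ℝ} (hs : MeasurableSet s) :
    (Measure.sum fun i => ENNReal.ofReal (w i) • Measure.dirac (E i)) s =
      ∑' i, ENNReal.ofReal (w i) * s.indicator 1 (E i) := by
  rw [Measure.sum_apply _ hs]
  refine tsum_congr fun i => ?_
  rw [Measure.smul_apply, Measure.dirac_apply' _ hs, smul_eq_mul]

/-- `Σ_i w_i δ_{E_i}` is a finite measure when `w ≥ 0` is summable. -/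
theorem isFiniteMeasure_sum_dirac (w E : ι → ℝ) (hw : ∀ i, 0 ≤ w i) (hs : Summable w) :
    IsFiniteMeasure (Measure.sum fun i => ENNReal.ofReal (w i) • Measure.dirac (E i)) := by
  refine ⟨?_⟩
  rw [sum_dirac_apply w E MeasurableSet.univ]
  simp only [indicator_univ, Pi.one_apply, mul_one]
  rw [← ENNReal.ofReal_tsum_of_nonneg hw hs]
  exact ENNReal.ofReal_lt_top

/-- `Σ_i w_i δ_{E_i}` gives no mass to a set avoiding every `E_i`. -/
theorem sum_dirac_apply_eq_zero (w E : ι → ℝ) {s : Set ℝ} (hs : MeasurableSet s) (hE : ∀ i, E i ∉ s) :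
    (Measure.sum fun i => ENNReal.ofReal (w i) • Measure.dirac (E i)) s = 0 := by
  rw [sum_dirac_apply w E hs]
  simp [indicator_of_notMem (hE _)]

/-- with all atoms in `(0,∞)`: `ν((-∞,0]) = 0`, the support clause of the pair spectral representation. -/
theorem sum_dirac_Iic_zero (w E : ι → ℝ) (hE : ∀ i, 0 < E i) :
    (Measure.sum fun i => ENNReal.ofReal (w i) • Measure.dirac (E i)) (Iic 0) = 0 :=
  sum_dirac_apply_eq_zero w E measurableSet_Iic fun i h => (not_le.mpr (hE i)) h

/-- **Integration against `Σ_i w_i δ_{E_i}`**: for measurable `g` bounded on `(0,∞)` (atoms in `(0,∞)`, `w ≥ 0` summable),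
`Σ_i w_i g(E_i)` converges to `∫ g dν`. -/
theorem hasSum_integral_sum_dirac [Countable ι] (w E : ι → ℝ) (hw : ∀ i, 0 ≤ w i) (hs : Summable w) (hE : ∀ i, 0 < E i)
    (g : ℝ → ℝ) (hg : Measurable g) {B : ℝ} (hB : ∀ x, 0 < x → |g x| ≤ B) :
    HasSum (fun i => w i * g (E i))
      (∫ x, g x ∂(Measure.sum fun i => ENNReal.ofReal (w i) • Measure.dirac (E i))) := by
  haveI := isFiniteMeasure_sum_dirac w E hw hs
  set ν : Measure ℝ := Measure.sum fun i => ENNReal.ofReal (w i) • Measure.dirac (E i) with hν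
  have hae : ∀ᵐ x ∂ν, (0:ℝ) < x := by
    filter_upwards [measure_eq_zero_iff_ae_notMem.1 (sum_dirac_Iic_zero w E hE)] with x hx
    exact not_le.1 hx
  have hI : Integrable g ν := by
    refine (integrable_const B).mono' hg.aestronglyMeasurable ?_
    filter_upwards [hae] with x hx
    rw [Real.norm_eq_abs]; exact hB x hx
  have h := hasSum_integral_measure hI
  have hterm : ∀ i, ∫ x, g x ∂(ENNReal.ofReal (w i) • Measure.dirac (E i)) = w i * g (E i) := fun i => by
    rw [integral_smul_measure, integral_dirac, ENNReal.toReal_ofReal (hw i), smul_eq_mul]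
  simpa only [hterm] using h

/-- **The clause-(i) integrand.**  For `0 ≤ a`, `0 ≤ b`: `Σ_i w_i (e^{-E_i a} + e^{-E_i b}) = ∫ (e^{-xa} + e^{-xb}) dν(x)`. -/
theorem hasSum_pairProfile_sum_dirac [Countable ι] (w E : ι → ℝ) (hw : ∀ i, 0 ≤ w i) (hs : Summable w) (hE : ∀ i, 0 < E i)
    {a b : ℝ} (ha : 0 ≤ a) (hb : 0 ≤ b) :
    HasSum (fun i => w i * (Real.exp (-(E i * a)) + Real.exp (-(E i * b))))
      (∫ x, (Real.exp (-(x * a)) + Real.exp (-(x * b))) ∂(Measure.sum fun i => ENNReal.ofReal (w i) • Measure.dirac (E i))) := by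
  refine hasSum_integral_sum_dirac w E hw hs hE (fun x => Real.exp (-(x * a)) + Real.exp (-(x * b)))
    (by fun_prop) (B := 2) fun x hx => ?_
  have h1 : Real.exp (-(x * a)) ≤ 1 := Real.exp_le_one_iff.mpr (by nlinarith)
  have h2 : Real.exp (-(x * b)) ≤ 1 := Real.exp_le_one_iff.mpr (by nlinarith)
  rw [abs_of_nonneg (by positivity)]
  linarith

/-- **Packaging in the shape of clause (i).**  If a sequence `c : ℕ → ℝ` is given on a range by
`c t = κ₀ + Σ_i w_i (e^{-E_i (t-δ)} + e^{-E_i (N-δ-t)})` (`w ≥ 0` summable, `E_i > 0`, `δ ≤ t`, `t ≤ N - δ` on the range), then there is a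
finite measure `ν` on `(0,∞)` with `c t = κ₀ + ∫ (e^{-E(t-δ)} + e^{-E(N-δ-t)}) dν(E)` on that range. -/
theorem exists_measure_of_hasSum_pairProfile [Countable ι] (w E : ι → ℝ) (hw : ∀ i, 0 ≤ w i) (hs : Summable w) (hE : ∀ i, 0 < E i)
    (c : ℕ → ℝ) (κ₀ : ℝ) (δ N t₀ t₁ : ℕ) (hδ : δ ≤ t₀) (ht₁ : t₁ + δ ≤ N)
    (hc : ∀ t : ℕ, t₀ ≤ t → t ≤ t₁ →
      HasSum (fun i => w i * (Real.exp (-(E i * ((t : ℝ) - δ))) + Real.exp (-(E i * ((N : ℝ) - δ - t))))) (c t - κ₀)) :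
    ∃ ν : Measure ℝ, IsFiniteMeasure ν ∧ ν (Iic 0) = 0 ∧ ∀ t : ℕ, t₀ ≤ t → t ≤ t₁ →
      c t = κ₀ + ∫ x, (Real.exp (-(x * ((t : ℝ) - δ))) + Real.exp (-(x * ((N : ℝ) - δ - t)))) ∂ν := by
  refine ⟨Measure.sum fun i => ENNReal.ofReal (w i) • Measure.dirac (E i), isFiniteMeasure_sum_dirac w E hw hs,
    sum_dirac_Iic_zero w E hE, fun t ht0 ht1 => ?_⟩
  have ha : (0:ℝ) ≤ (t : ℝ) - δ := by
    have : (δ : ℝ) ≤ t := by exact_mod_cast hδ.trans ht0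
    linarith
  have hb : (0:ℝ) ≤ (N : ℝ) - δ - t := by
    have : ((t + δ : ℕ) : ℝ) ≤ N := by exact_mod_cast (Nat.add_le_add_right ht1 δ).trans ht₁
    push_cast at this; linarith
  have h := hasSum_pairProfile_sum_dirac w E hw hs hE ha hb
  have := (hc t ht0 ht1).unique h
  linarith

end Summit.QuantumFields.YangMills.Cruxes.MirrorMonotoneDecay.DiscreteSpectral
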